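import Summits.SmoothPoincare4.SmoothPoincare4.Theorems.ConvexBisectionAcyclicBisectionExistsChartedChainPassageLoop
import Summits.SmoothPoincare4.SmoothPoincare4.Theorems.ConvexBisectionAcyclicBisectionExistsChartedChainCoreShadow
import Summits.SmoothPoincare4.SmoothPoincare4.Theorems.ConvexBisectionAcyclicBisectionExistsChartedChainExclusions
import Summits.SmoothPoincare4.SmoothPoincare4.Theorems.ConvexBisectionAcyclicBisectionExistsCrossingNumberShadow
import HarnessLib

/-!
# One clean climbing passage: the crossing number of the charted vanishing cycle with the next
# one is `+1`
(wave 4, brick Y4-4b of the model chain (R2) `exists_charted_chain` for the missing lemma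
`crossingNumber_eq_stdSymp` of node N1a of stub `stub_modelsOnFibred_of_reach` = NF4, line
`modp-braid-orbits`, crux `ConvexBisection.AcyclicBisectionExists`, item stmt-SmoothPoincare4-10508;
registered sub-goal `helper_crossingNumber_cycle_next`)

`ψ = cycleChart` is the annulus chart of the vanishing cycle of `page g c` over the symmetric chord
`[ζ_{2g}, ζ_0]` (core `b`), `baseRot g 1 ∘ b` the next vanishing cycle (over `[ζ_0, ζ_1]`; shadow
`chainVec g 0`, `…ChartedChainCoreShadow.lean`), and `K` the passage loop of
`…ChartedChainPassageLoop.lean` (a page loop with the same shadow).  Then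

  **`crossingNumber ψ (baseRot g 1 ∘ b) = crossingNumber ψ K = 1`** (`helper_crossingNumber_cycle_next`).

The first equality is `crossingNumber_eq_of_shadow_eq` (Z6-3).  For the second,
`crossingNumber_single_passage` (Z6-4) with `s = 5/8`, `t = 3/4`: on `[5/8, 3/4]` the loop IS the
radial line `u = 1/4` of the chart from height `−3/4` to height `3/4` (`passage_eq`), and it is off
the closed collar `ψ(ℝ × [−1/2, 1/2])` elsewhere (`passage_off`), by the exclusion principles
(X1)–(X3) of `…ChartedChainExclusions.lean` — the chord and the approach segment by (X1), the real
segment on the way out by (X2), the straight segment to `ζ_1` by (X3).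
Everything is proved; no `sorry`.  References: B. Farb, D. Margalit, *A primer on mapping class
groups* (2012), §6.1 [FarbMargalit2012]; W. Fulton, *Algebraic Topology* (1995), §3 [Fulton1995].
-/

noncomputable section

set_option linter.dupNamespace false

open scoped Manifold ContDiff Topology ComplexConjugate Real
open Set Function Metric Complex
open Literature.Topology.FourManifolds Literature.Topology.FourManifolds.LefschetzBase
  Literature.Topology.FourManifolds.TorusKnotMilnor

namespace Summit.SmoothPoincare4.SmoothPoincare4.Theorems.AcyclicBisectionExists.ModpBraidOrbits

variable {g : ℕ} {c : ℂ}

/-! ## §1 The passage loop: where it is, relative to the chart -/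

variable {K : sphere (0 : EuclideanSpace ℝ (Fin 2)) 1 → Base g}

/-- **Off the collar outside `(5/8, 3/4)`.** [folklore] -/
theorem passage_off (hg : 1 ≤ g) (hc : ‖c‖ ≤ 1)
    (hKτ : ∀ τ ∈ Icc (0 : ℝ) 1, (K (circlePt τ)).1 = sheetAmb g c τ (passX g τ)) {τ : ℝ}
    (hτ : τ ∈ Icc (0 : ℝ) (5 / 8) ∨ τ ∈ Icc (3 / 4 : ℝ) 1) :
    K (circlePt τ) ∉ cycleChart hg hc '' (univ ×ˢ Icc (-(1 / 2) : ℝ) (1 / 2)) := by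
  have hτ01 : τ ∈ Icc (0 : ℝ) 1 := hτ.elim (fun h => ⟨h.1, by linarith [h.2]⟩) fun h => ⟨by linarith [h.1], h.2⟩
  have hq := hKτ τ hτ01
  have hcx : cx (K (circlePt τ)).1 = scaleX g c * passX g τ := by rw [hq, sheetAmb, cx_pagePt]
  have h34 : radP g (3 / 4) < radP g (1 / 2) :=
    strictAntiOn_radP g ⟨by norm_num, by norm_num⟩ ⟨by norm_num, by norm_num⟩ (by norm_num)
  -- case analysis on the position of `τ`
  by_cases hA : τ ≤ 1 / 8
  · -- upper chord
    have hv : 2 * τ ∈ Icc (0 : ℝ) (1 / 4) := ⟨by linarith [hτ01.1], by linarith⟩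
    rw [(passX_pieces g τ).1 ⟨hτ01.1, by linarith⟩, (gam_pieces g _).1 hv] at hcx
    exact not_mem_collar_of_norm_lt hg hc hcx (by rw [Complex.norm_exp_ofReal_mul_I])
      (by rw [Complex.norm_exp_ofReal_mul_I]; exact one_lt_radP g _)
  by_cases hB : τ ≤ 1 / 4
  · -- upper approach segment
    have hv : 2 * τ ∈ Icc (1 / 4 : ℝ) (1 / 2) := ⟨by linarith [not_le.1 hA], by linarith⟩
    rw [(passX_pieces g τ).1 ⟨hτ01.1, by linarith⟩, (gam_pieces g _).2.1 hv] at hcx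
    have hn : ‖I * (rhoB g (2 * τ) : ℂ)‖ = rhoB g (2 * τ) := by
      rw [norm_mul, Complex.norm_I, one_mul, Complex.norm_real, Real.norm_eq_abs, abs_of_pos (by linarith [(rhoB_mem g hv).1])]
    exact not_mem_collar_of_norm_lt hg hc hcx (by rw [hn]; exact (rhoB_mem g hv).1)
      (by rw [hn]; exact lt_of_le_of_lt (rhoB_mem g hv).2 h34)
  by_cases hC : τ ≤ 3 / 8
  · -- upper real segment: not in the image of the chart at all
    have hv : 2 * τ ∈ Icc (1 / 2 : ℝ) (3 / 4) := ⟨by linarith [not_le.1 hB], by linarith⟩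
    rintro ⟨p, -, hp⟩
    refine not_mem_image_of_upper hg hc (one_lt_radP g (15 / 4 - 6 * (2 * τ))).le (radP_le' g _) ?_ p hp
    rw [hq, sheetAmb, halfSign, if_pos (by linarith), one_mul, (passX_pieces g τ).1 ⟨hτ01.1, by linarith⟩,
      (gam_pieces g _).2.2.1 hv]
  by_cases hD : τ ≤ 5 / 8
  · -- the straight segment to `ζ_1`, on either sheet
    have key : ∀ v ∈ Icc (3 / 4 : ℝ) 1, (gam g v).re ≤ (jX g (I * radP g (-(3 / 4)))).re := by
      intro v hv
      rw [(gam_pieces g v).2.2.2 hv, Complex.add_re, Complex.re_ofReal_mul, Complex.sub_re]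
      have := re_branchPt_one_le hg
      nlinarith [hv.1, hv.2]
    refine not_mem_collar_of_re_le hg hc hcx ?_
    by_cases h5 : τ ≤ 1 / 2
    · rw [(passX_pieces g τ).1 ⟨hτ01.1, h5⟩]; exact key _ ⟨by linarith [not_le.1 hC], by linarith⟩
    · rw [(passX_pieces g τ).2 ⟨(not_le.1 h5).le, hτ01.2⟩]; exact key _ ⟨by linarith, by linarith [not_le.1 h5]⟩
  -- past the passage
  have hτ' : τ ∈ Icc (3 / 4 : ℝ) 1 := hτ.elim (fun h => absurd h.2 hD) id
  by_cases hE : τ ≤ 7 / 8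
  · -- lower approach segment
    have hv : 2 - 2 * τ ∈ Icc (1 / 4 : ℝ) (1 / 2) := ⟨by linarith, by linarith [hτ'.1]⟩
    rw [(passX_pieces g τ).2 ⟨by linarith [hτ'.1], hτ01.2⟩, (gam_pieces g _).2.1 hv] at hcx
    have hn : ‖I * (rhoB g (2 - 2 * τ) : ℂ)‖ = rhoB g (2 - 2 * τ) := by
      rw [norm_mul, Complex.norm_I, one_mul, Complex.norm_real, Real.norm_eq_abs, abs_of_pos (by linarith [(rhoB_mem g hv).1])]
    exact not_mem_collar_of_norm_lt hg hc hcx (by rw [hn]; exact (rhoB_mem g hv).1)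
      (by rw [hn]; exact lt_of_le_of_lt (rhoB_mem g hv).2 h34)
  · -- lower chord
    have hv : 2 - 2 * τ ∈ Icc (0 : ℝ) (1 / 4) := ⟨by linarith [hτ01.2], by linarith [not_le.1 hE]⟩
    rw [(passX_pieces g τ).2 ⟨by linarith [hτ'.1], hτ01.2⟩, (gam_pieces g _).1 hv] at hcx
    exact not_mem_collar_of_norm_lt hg hc hcx (by rw [Complex.norm_exp_ofReal_mul_I])
      (by rw [Complex.norm_exp_ofReal_mul_I]; exact one_lt_radP g _)

/-- **On `[5/8, 3/4]` the passage loop is the radial line `u = 1/4` of the chart at height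
`12τ − 33/4`.** [folklore] -/
theorem passage_eq (hg : 1 ≤ g) (hc : ‖c‖ ≤ 1)
    (hKτ : ∀ τ ∈ Icc (0 : ℝ) 1, (K (circlePt τ)).1 = sheetAmb g c τ (passX g τ)) {τ : ℝ}
    (hτ : τ ∈ Icc (5 / 8 : ℝ) (3 / 4)) :
    K (circlePt τ) = cycleChart hg hc (1 / 4, 12 * τ - 33 / 4) := by
  apply Subtype.ext
  have hv : 2 - 2 * τ ∈ Icc (1 / 2 : ℝ) (3 / 4) := ⟨by linarith [hτ.2], by linarith [hτ.1]⟩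
  rw [hKτ τ ⟨by linarith [hτ.1], by linarith [hτ.2]⟩, sheetAmb, halfSign, if_neg (by linarith [hτ.1]),
    (passX_pieces g τ).2 ⟨by linarith [hτ.1], by linarith [hτ.2]⟩, (gam_pieces g _).2.2.1 hv,
    show (15 / 4 - 6 * (2 - 2 * τ) : ℝ) = 12 * τ - 33 / 4 by ring, cycleChart_val, cycleAmb, tParam_quarter,
    jY_I_mul_eq_neg_csqrt hg (one_lt_radP g _).le (radP_le' g _), neg_one_mul]

/-! ## §2 The crossing numbers -/

/-- **The passage loop crosses the chart once, climbing: `crossingNumber ψ K = 1`.**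
[cite: Fulton1995, §3] -/
theorem crossingNumber_passageLoop (hg : 1 ≤ g) (hc : ‖c‖ = 1) (hK : Continuous K) (hKp : ∀ θ, K θ ∈ page g c)
    (hKτ : ∀ τ ∈ Icc (0 : ℝ) 1, (K (circlePt τ)).1 = sheetAmb g c τ (passX g τ)) :
    crossingNumber (cycleChart hg hc.le) K = 1 := by
  have hψ1 := cycleChart_periodic hg hc.le
  have hψi := cycleChart_injOn hg hc.le
  have hr : ∀ τ ∈ Icc (5 / 8 : ℝ) (3 / 4), 12 * τ - 33 / 4 ∈ Ioo (-1 : ℝ) 1 := fun τ hτ =>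
    ⟨by linarith [hτ.1], by linarith [hτ.2]⟩
  refine crossingNumber_single_passage hc (continuous_cycleChart hg hc.le) hψ1 (cycleChart_mem_page hg hc.le) hψi hK
    hKp (s := 5 / 8) (t := 3 / 4) (by norm_num) (by norm_num) (by norm_num) ?_ ?_ ?_ ?_ ?_
  · intro τ hτ
    exact ⟨(1 / 4, 12 * τ - 33 / 4), ⟨trivial, hr τ hτ⟩, (passage_eq hg hc.le hKτ hτ).symm⟩
  · exact fun τ hτ => passage_off hg hc.le hKτ (Or.inl hτ)
  · exact fun τ hτ => passage_off hg hc.le hKτ (Or.inr hτ)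
  · rw [passage_eq hg hc.le hKτ ⟨le_rfl, by norm_num⟩, height_of_lift hψ1 hψi (by norm_num)]; norm_num
  · rw [passage_eq hg hc.le hKτ ⟨by norm_num, le_rfl⟩, height_of_lift hψ1 hψi (by norm_num)]; norm_num

/-- **Sub-goal `helper_crossingNumber_cycle_next`** (Y4-4 of the model chain (R2) for node N1a of
NF4): the annulus chart `cycleChart` of the vanishing cycle of `page g c` over `[ζ_{2g}, ζ_0]`
(core `b`) crosses the next vanishing cycle `baseRot g 1 ∘ b` (over `[ζ_0, ζ_1]`) with crossing
number `+1` (`g ≥ 1`, `‖c‖ = 1`). [cite: FarbMargalit2012, §6.1] -/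
theorem helper_crossingNumber_cycle_next : ∀ (g : ℕ) (c : ℂ) (hg : 1 ≤ g) (hc : ‖c‖ = 1) (b : Metric.sphere (0 : EuclideanSpace ℝ (Fin 2)) 1 → Literature.Topology.FourManifolds.LefschetzBase.Base g), (∀ u : ℝ, Summit.SmoothPoincare4.SmoothPoincare4.Theorems.AcyclicBisectionExists.ModpBraidOrbits.cycleChart hg hc.le (u, 0) = b (Literature.Topology.FourManifolds.circlePt u)) → Summit.SmoothPoincare4.SmoothPoincare4.Theorems.AcyclicBisectionExists.ModpBraidOrbits.crossingNumber (Summit.SmoothPoincare4.SmoothPoincare4.Theorems.AcyclicBisectionExists.ModpBraidOrbits.cycleChart hg hc.le) (Summit.SmoothPoincare4.SmoothPoincare4.Theorems.AcyclicBisectionExists.ModpBraidOrbits.baseRot g 1 ∘ b) = 1 := by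
  intro g c hg hc b hbu
  have hc' : ‖c‖ ≤ 1 := hc.le
  obtain ⟨K, hK, hKp, hKτ, hKs⟩ := helper_passageLoop g c hg hc'
  -- the core and its rotation are continuous page loops
  have hb : Continuous b := by
    have h : b = fun θ => b (circlePt (Classical.choose (exists_Icc_circlePt_eq θ))) := by
      funext θ; rw [(Classical.choose_spec (exists_Icc_circlePt_eq θ)).2]
    obtain ⟨b', hb', hb'u⟩ := exists_cycleCore hg hc'
    have e : b = b' := by
      funext θ
      obtain ⟨τ, -, rfl⟩ := exists_Icc_circlePt_eq θ
      rw [← hbu, hb'u]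
    rw [e]; exact hb'
  have hb1 : Continuous (baseRot g 1 ∘ b) := (continuous_baseRot g 1).comp hb
  have hbp : ∀ θ, (baseRot g 1 ∘ b) θ ∈ page g c := fun θ => by
    obtain ⟨τ, -, rfl⟩ := exists_Icc_circlePt_eq θ
    rw [comp_apply, baseRot_mem_page_iff, ← hbu]
    exact cycleChart_mem_page hg hc' _
  have hsh : shadow g (baseRot g 1 ∘ b) hb1 = shadow g K hK := by
    rw [hKs]
    exact helper_shadow_baseRot_cycleCore g c hg hc' b hbu 0 (by omega) hb1
  rw [crossingNumber_eq_of_shadow_eq hc (continuous_cycleChart hg hc') (cycleChart_periodic hg hc')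
    (cycleChart_mem_page hg hc') (cycleChart_injOn hg hc') hb1 hbp hK hKp hsh]
  exact crossingNumber_passageLoop hg hc hK hKp hKτ

end Summit.SmoothPoincare4.SmoothPoincare4.Theorems.AcyclicBisectionExists.ModpBraidOrbits

end
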